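import Literature.NumberTheory.GaloisRepresentations.ResidualGaloisRep
import HarnessLib

/-!
# Uniqueness of residual representations (Brauer–Nesbitt) and residual irreducibility

Theorems only (no definition of a notion, no named fact; D-0026), written by the seat of the
named fact `Literature.NumberTheory.Automorphic.Allen2014_modularity_nearlyOrdinaryDihedral_Q`.
The module `Literature/NumberTheory/GaloisRepresentations/ResidualGaloisRep.lean` defines
reductions and residual representations (= semisimplified reductions) relative to a valuation
subring `O ⊆ F` and announces that the latter are "well defined up to `GL_n(k)`-conjugacy by
Brauer–Nesbitt (`IsResidualRepOf.unique`)"; this file supplies that uniqueness (as an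
equivalence of representations) and its first consequence for the chosen `ρ.residualRep` of a
residually absolutely irreducible `ρ : Γ_K → GL_n(ℚ̄_ℓ)` — it is a genuine residual
representation and it is irreducible.  (Allen 2014, Introduction: "`ρ̄` … the residual
representation associated to `ρ` … (4) `ρ̄` is absolutely irreducible".)

* `HasResidualCharpolys.charpoly_eq`, `IsResidualRepOf.charpoly_eq` — two residual
  representations of `ρ` along the same residue embedding have the same characteristic
  polynomials (both reduce the UNIQUE lift of `charpoly ρ(g)` to `O[X]`, `O → F` being
  injective).
* `IsResidualRepOf.nonempty_equiv` — hence they are equivalent (Brauer–Nesbitt over an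
  arbitrary field, the tree's `brauerNesbitt_holds`): the `IsResidualRepOf.unique` of the module
  docstring of `ResidualGaloisRep`.
* `IsAbsIrreducible.isIrreducible_glRepresentation`,
  `IsResidualRepOf.isIrreducible_of_isResiduallyAbsIrreducible` — a residual representation (over
  the residue field itself) of a residually absolutely irreducible `ρ` is irreducible.
* `FramedGaloisRep.residualRep_spec_of_isResiduallyAbsIrreducible` — for
  `ρ : Γ_K → GL_n(ℚ̄_ℓ)` residually absolutely irreducible: `ρ.residualRep` is a residual
  representation of `ρ` AND is irreducible.

References: Darmon–Diamond–Taylor, *Fermat's Last Theorem* (1995), §2.1, Prop. 2.6 (b) and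
p. 54 [DarmonDiamondTaylor1995]; Bourbaki, *Algèbre* VIII § 20 n° 6 (Brauer–Nesbitt)
[BourbakiAlgebreVIII2012].
-/

noncomputable section

open scoped MatrixGroups
open Matrix IsLocalRing

namespace Literature.NumberTheory.GaloisRepresentations

section General

variable {F : Type*} [Field F] {O : ValuationSubring F} {G : Type*} [Group G] {n : ℕ}
variable {k : Type*} [Field k] {ι : ResidueField O →+* k}

/-- **Residual characteristic polynomials are unique**: if `τ` and `σ` both have the residual
characteristic polynomials of `ρ` (along `ι`), then `charpoly τ(g) = charpoly σ(g)` — the lift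
of `charpoly ρ(g)` to `O[X]` is unique because `O[X] → F[X]` is injective. [folklore] -/
theorem HasResidualCharpolys.charpoly_eq {ρ : G →* GL (Fin n) F} {τ σ : G →* GL (Fin n) k}
    (hτ : HasResidualCharpolys ι ρ τ) (hσ : HasResidualCharpolys ι ρ σ) (g : G) :
    ((τ g : GL (Fin n) k) : Matrix (Fin n) (Fin n) k).charpoly =
      ((σ g : GL (Fin n) k) : Matrix (Fin n) (Fin n) k).charpoly := by
  obtain ⟨P, hP, hPτ⟩ := hτ g
  obtain ⟨Q, hQ, hQσ⟩ := hσ g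
  have hPQ : P = Q :=
    Polynomial.map_injective O.subtype O.subtype_injective (hP.trans hQ.symm)
  rw [← hPτ, ← hQσ, hPQ]

/-- **Two residual representations of `ρ` along the same residue embedding have the same
characteristic polynomials** (Darmon–Diamond–Taylor 1995, Prop. 2.6 (b)).
[cite: DarmonDiamondTaylor1995, §2.1, Prop. 2.6 (b)] -/
theorem IsResidualRepOf.charpoly_eq {ρ : G →* GL (Fin n) F} {τ σ : G →* GL (Fin n) k}
    (hτ : IsResidualRepOf ι ρ τ) (hσ : IsResidualRepOf ι ρ σ) (g : G) :
    ((τ g : GL (Fin n) k) : Matrix (Fin n) (Fin n) k).charpoly =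
      ((σ g : GL (Fin n) k) : Matrix (Fin n) (Fin n) k).charpoly :=
  hτ.hasResidualCharpolys.charpoly_eq hσ.hasResidualCharpolys g

/-- **Uniqueness of residual representations** (the `IsResidualRepOf.unique` announced in
`ResidualGaloisRep`): two residual representations of `ρ` along the same residue embedding are
equivalent as representations on `kⁿ` — both are semisimple with the same characteristic
polynomials, so Brauer–Nesbitt (`brauerNesbitt_holds`, any characteristic) applies.
[cite: DarmonDiamondTaylor1995, §2.1, Prop. 2.6 (b)] -/
theorem IsResidualRepOf.nonempty_equiv {ρ : G →* GL (Fin n) F} {τ σ : G →* GL (Fin n) k}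
    (hτ : IsResidualRepOf ι ρ τ) (hσ : IsResidualRepOf ι ρ σ) :
    Nonempty ((glRepresentation τ).Equiv (glRepresentation σ)) := by
  refine brauerNesbitt_holds (glRepresentation τ) (glRepresentation σ)
    hτ.isSemisimpleRepresentation hσ.isSemisimpleRepresentation fun g => ?_
  have eτ : (glRepresentation τ g : (Fin n → k) →ₗ[k] (Fin n → k)) =
      Matrix.toLin' ((τ g : GL (Fin n) k) : Matrix (Fin n) (Fin n) k) :=
    LinearMap.ext fun v => by rw [Matrix.toLin'_apply]; rfl
  have eσ : (glRepresentation σ g : (Fin n → k) →ₗ[k] (Fin n → k)) =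
      Matrix.toLin' ((σ g : GL (Fin n) k) : Matrix (Fin n) (Fin n) k) :=
    LinearMap.ext fun v => by rw [Matrix.toLin'_apply]; rfl
  rw [eτ, eσ, Matrix.charpoly_toLin', Matrix.charpoly_toLin']
  exact hτ.charpoly_eq hσ g

/-- Absolutely irreducible ⇒ irreducible over the base field (the case `f = id`). [folklore] -/
theorem IsAbsIrreducible.isIrreducible_glRepresentation {τ : G →* GL (Fin n) k}
    (h : IsAbsIrreducible τ) : (glRepresentation τ).IsIrreducible := by
  have h1 := h k (RingHom.id k)
  rwa [Matrix.GeneralLinearGroup.map_id, MonoidHom.id_comp] at h1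

/-- **A residual representation of a residually absolutely irreducible `ρ` is irreducible** (over
the residue field, `ι = id`): it is equivalent (`IsResidualRepOf.nonempty_equiv`) to the
absolutely irreducible reduction. [folklore] -/
theorem IsResidualRepOf.isIrreducible_of_isResiduallyAbsIrreducible {ρ : G →* GL (Fin n) F}
    {σ : G →* GL (Fin n) (ResidueField O)} (hσ : IsResidualRepOf (RingHom.id _) ρ σ)
    (h : IsResiduallyAbsIrreducible O ρ) : (glRepresentation σ).IsIrreducible := by
  obtain ⟨τ, hτ, habs⟩ := h
  haveI hirr : (glRepresentation τ).IsIrreducible := habs.isIrreducible_glRepresentation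
  have hτ' : IsResidualRepOf (RingHom.id _) ρ τ := hτ.isResidualRepOf_of_isIrreducible hirr
  obtain ⟨e⟩ := hτ'.nonempty_equiv hσ
  exact Literature.RepresentationTheory.Semisimple.Representation.isIrreducible_of_equiv e

end General

/-! ### The `ℚ̄_ℓ` case -/

section PadicAlgCl

variable {K : Type*} [Field K] {ℓ : ℕ} [Fact ℓ.Prime] {n : ℕ}

/-- **The chosen residual representation of a residually absolutely irreducible
`ρ : Γ_K → GL_n(ℚ̄_ℓ)` is a genuine, irreducible residual representation**: the absolutely
irreducible reduction witnesses the existence hypothesis of `residualRep_spec` (no junk value),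
and irreducibility follows from `IsResidualRepOf.isIrreducible_of_isResiduallyAbsIrreducible`.
(Allen 2014, Introduction, hypothesis (4): "`ρ̄` is absolutely irreducible".) [folklore] -/
theorem FramedGaloisRep.residualRep_spec_of_isResiduallyAbsIrreducible
    (ρ : FramedGaloisRep K (PadicAlgCl ℓ) n) (h : ρ.IsResiduallyAbsIrreducible) :
    ρ.IsResidualRepOf (RingHom.id _) ρ.residualRep ∧ (glRepresentation ρ.residualRep).IsIrreducible := by
  have hex : ∃ τ, ρ.IsResidualRepOf (RingHom.id _) τ := by
    obtain ⟨τ, hτ, habs⟩ := h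
    exact ⟨τ, hτ.isResidualRepOf_of_isIrreducible habs.isIrreducible_glRepresentation⟩
  have hspec := ρ.residualRep_spec hex
  exact ⟨hspec, hspec.isIrreducible_of_isResiduallyAbsIrreducible h⟩

end PadicAlgCl

end Literature.NumberTheory.GaloisRepresentations
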